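import Summits.ABC.StewartYu.PadicTwistValues
import Mathlib.RingTheory.RootsOfUnity.PrimitiveRoots
import HarnessLib

/-!
# Cell abc-stewartyu, WP-Y provider B (viii): exponent classes and signs for the ± class chain

`Summits/ABC/StewartYu/PadicTwistPMExpClass.lean` — cell `abc-stewartyu`, seat p3 (crux `W80OneModFour`
stmt-ABC-19487; memo-05 §3–§5, memo-03 §2 (II)). ADD-ON on p2's re-landed any-order twist chain: with
`ηᵢ = ζ^{rᵢ}` for a primitive `2M`-th root of unity `ζ`, the ± class `cls u = ±cls u₀` on the support
gives the exponent class `∑ rᵢ expnᵢ(u,s) ≡ c₀ (mod M)` (`expClass_of_pm`); the parity of the quotient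
detects the exact sub-class (`cls_eq_iff_parity`); part 4's restricted class-sum vector is part 3's signed
parity vector (`classVec_restrict_eq`); and the signs at the point `s` (data `s·k₁`) differ from the
`s`-independent ones (`k₁`) by a global factor per parity class (`neg_one_pow_mul_div_two`,
`signedVec_mul_eq`). Kernel-checked beforehand in HOME/p3/lean/pm/CHECK_PM_chain.lean. [folklore].
-/

noncomputable section

open NormedSpace Finset IsUltrametricDist
open Literature.NumberTheory.Transcendental
open Literature.NumberTheory.Transcendental.CW77.Setup (Idx Tau tauNorm)
open scoped Nat

namespace Summit.ABC.StewartYu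

/-! ## HalfStepPM (provider B), part 5a — the exponent class from the ± class (memo-05 §3/§5): with
`ηᵢ = ζ^{rᵢ}`, `ζ` a primitive `2M`-th root of unity, the ± class `cls u = ±cls u₀` on the support forces
`E(u) := ∑ rᵢ·expnᵢ(u,s) ≡ E(u₀) (mod M)` at odd `s`, i.e. `E(u) = c₀ + k(u)·M` with `c₀ = E(u₀) mod M`,
`k(u) = E(u) div M` — the hypothesis `hcls` of parts 2–3. -/

namespace TwistSetup

variable {p : ℕ} [Fact p.Prime] (S : TwistSetup p) {h Lb : ℕ}

/-- Residues mod `M` from a ± coincidence of powers of a primitive `2M`-th root of unity. [folklore] -/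
theorem mod_eq_mod_of_pow_eq_pm {ζ : ℚ_[p]} {M : ℕ} (hM : 0 < M) (hζ : IsPrimitiveRoot ζ (2 * M))
    {a b : ℕ} (hab : ζ ^ a = ζ ^ b ∨ ζ ^ a = -ζ ^ b) : a % M = b % M := by
  have h2M : 0 < 2 * M := by omega
  have hζM : ζ ^ M = -1 :=
    (hζ.pow h2M (show 2 * M = M * 2 by ring)).eq_neg_one_of_two_right
  have hone : ζ ^ (2 * M) = 1 := hζ.pow_eq_one
  -- reduce exponents mod `2M`
  have hred : ∀ n : ℕ, ζ ^ n = ζ ^ (n % (2 * M)) := by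
    intro n
    conv_lhs => rw [← Nat.mod_add_div n (2 * M), pow_add, pow_mul, hone, one_pow, mul_one]
  -- in both cases `ζ^a = ζ^{b'}` with `b' ∈ {b, b + M}`
  obtain ⟨b', hb', hbb'⟩ : ∃ b' : ℕ, ζ ^ a = ζ ^ b' ∧ b' % M = b % M := by
    rcases hab with h1 | h1
    · exact ⟨b, h1, rfl⟩
    · refine ⟨b + M, ?_, by simp⟩
      rw [h1, pow_add, hζM]; ring
  rw [hred a, hred b'] at hb'
  have hlt : ∀ n : ℕ, n % (2 * M) < 2 * M := fun n => Nat.mod_lt _ h2M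
  have hinj := hζ.pow_inj (hlt a) (hlt b') hb'
  -- `a ≡ b' (mod 2M)` ⇒ `a ≡ b' (mod M)`
  have hdvd : M ∣ 2 * M := ⟨2, by ring⟩
  rw [← Nat.mod_mod_of_dvd a hdvd, hinj, Nat.mod_mod_of_dvd b' hdvd, hbb']

/-- **The exponent class on the support** (odd `s`): if `ηᵢ = ζ^{rᵢ}` for a primitive `2M`-th root of
unity `ζ` and `cls u = ±cls u₀` whenever `c u ≠ 0` (`u ∈ box`), then
`∑ rᵢ expnᵢ(u,s) = (∑ rᵢ expnᵢ(u₀,s)) mod M + (∑ rᵢ expnᵢ(u,s)) div M · M` for all such `u`. [folklore] -/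
theorem expClass_of_pm {ζ : ℚ_[p]} {M : ℕ} (hM : 0 < M) (hζ : IsPrimitiveRoot ζ (2 * M))
    (r : Fin (S.d + 1) → ℕ) (hη : ∀ i, S.η i = ζ ^ r i) (box : Finset (Idx S.d h Lb))
    (c : Idx S.d h Lb → ℤ) (u₀ : Idx S.d h Lb)
    (hpm : ∀ u ∈ box, c u ≠ 0 → S.cls u = S.cls u₀ ∨ S.cls u = -S.cls u₀) {s : ℕ} (hs : Odd s) :
    ∀ u ∈ box, c u ≠ 0 →
      ∑ i, r i * S.frame.expn u s i =
        (∑ i, r i * S.frame.expn u₀ s i) % M + (∑ i, r i * S.frame.expn u s i) / M * M := by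
  intro u hu hc
  have hE : ∀ v : Idx S.d h Lb, ζ ^ (∑ i, r i * S.frame.expn v s i) = S.cls v ^ s := by
    intro v
    rw [S.cls_pow, ← prod_pow_eq_pow_sum]
    exact prod_congr rfl fun i _ => by rw [hη i, ← pow_mul]
  have hab : ζ ^ (∑ i, r i * S.frame.expn u s i) = ζ ^ (∑ i, r i * S.frame.expn u₀ s i) ∨
      ζ ^ (∑ i, r i * S.frame.expn u s i) = -ζ ^ (∑ i, r i * S.frame.expn u₀ s i) := by
    rw [hE, hE]
    rcases hpm u hu hc with h1 | h1
    · left; rw [h1]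
    · right; rw [h1, hs.neg_pow]
  have hmod := mod_eq_mod_of_pow_eq_pm hM hζ hab
  conv_lhs => rw [← Nat.mod_add_div (∑ i, r i * S.frame.expn u s i) M, hmod, mul_comm]

end TwistSetup


/-! ## HalfStepPM (provider B), part 5b — parity of the exponent class = the exact sub-class, and the
identification of part 4's restricted class vector with part 3's signed parity vector. -/

namespace TwistSetup

variable {p : ℕ} [Fact p.Prime] (S : TwistSetup p) {h Lb : ℕ}

/-- `cls u ^ s = ζ^{c₀} · (−1)^{k(u)}` from the exponent class `∑ rᵢ expnᵢ(u,s) = c₀ + k(u)·M`, `ζ^M = −1`.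
[folklore] -/
theorem cls_pow_eq_of_expClass {ζ : ℚ_[p]} {M : ℕ} (hζM : ζ ^ M = -1) (r : Fin (S.d + 1) → ℕ)
    (hη : ∀ i, S.η i = ζ ^ r i) (u : Idx S.d h Lb) (s : ℕ) {c₀ k : ℕ}
    (hE : ∑ i, r i * S.frame.expn u s i = c₀ + k * M) :
    S.cls u ^ s = ζ ^ c₀ * (-1) ^ k := by
  have h1 : ζ ^ (∑ i, r i * S.frame.expn u s i) = S.cls u ^ s := by
    rw [S.cls_pow, ← prod_pow_eq_pow_sum]
    exact prod_congr rfl fun i _ => by rw [hη i, ← pow_mul]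
  rw [← h1, hE, pow_add, pow_mul', hζM]

/-- **Parity of `k` detects the exact sub-class** (odd `s`, `cls u = ±cls u₀`): `cls u = cls u₀ ↔ k(u) ≡ k(u₀) (mod 2)`.
[folklore] -/
theorem cls_eq_iff_parity {ζ : ℚ_[p]} {M : ℕ} (hζM : ζ ^ M = -1) (hζ0 : ζ ≠ 0) (r : Fin (S.d + 1) → ℕ)
    (hη : ∀ i, S.η i = ζ ^ r i) {u u₀ : Idx S.d h Lb} {s c₀ ku ku₀ : ℕ} (hs : Odd s)
    (hEu : ∑ i, r i * S.frame.expn u s i = c₀ + ku * M)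
    (hEu₀ : ∑ i, r i * S.frame.expn u₀ s i = c₀ + ku₀ * M)
    (hpm : S.cls u = S.cls u₀ ∨ S.cls u = -S.cls u₀) :
    S.cls u = S.cls u₀ ↔ (Even ku ↔ Even ku₀) := by
  have hu := S.cls_pow_eq_of_expClass hζM r hη u s hEu
  have hu₀ := S.cls_pow_eq_of_expClass hζM r hη u₀ s hEu₀
  have hz : ζ ^ c₀ ≠ 0 := pow_ne_zero _ hζ0
  have hc0 : S.cls u₀ ^ s ≠ 0 := pow_ne_zero _ (S.cls_ne u₀)
  have htwo : (1 : ℚ_[p]) ≠ -1 := by norm_num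
  constructor
  · intro heq
    rw [heq] at hu
    have hk : ((-1 : ℚ_[p])) ^ ku = (-1) ^ ku₀ := mul_left_cancel₀ hz (hu.symm.trans hu₀)
    rcases Nat.even_or_odd ku with h1 | h1 <;> rcases Nat.even_or_odd ku₀ with h2 | h2
    · exact ⟨fun _ => h2, fun _ => h1⟩
    · rw [h1.neg_one_pow, h2.neg_one_pow] at hk; exact absurd hk htwo
    · rw [h1.neg_one_pow, h2.neg_one_pow] at hk; exact absurd hk.symm htwo
    · exact ⟨fun h => absurd h (Nat.not_even_iff_odd.mpr h1), fun h => absurd h (Nat.not_even_iff_odd.mpr h2)⟩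
  · intro hpar
    rcases hpm with heq | heq
    · exact heq
    · exfalso
      rw [heq, hs.neg_pow] at hu
      -- `-(cls u₀^s) = ζ^{c₀} (−1)^{ku}` and `cls u₀^s = ζ^{c₀} (−1)^{ku₀}` with the same parity
      have hk : ((-1 : ℚ_[p])) ^ ku = -(-1) ^ ku₀ := by
        have := hu.symm.trans (congrArg Neg.neg hu₀)
        rw [← mul_neg] at this
        exact mul_left_cancel₀ hz this
      rcases Nat.even_or_odd ku with h1 | h1
      · have h2 : Even ku₀ := hpar.mp h1
        rw [h1.neg_one_pow, h2.neg_one_pow] at hk; exact htwo hk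
      · have h2 : Odd ku₀ := by
          rcases Nat.even_or_odd ku₀ with h2 | h2
          · exact absurd (hpar.mpr h2) (Nat.not_even_iff_odd.mpr h1)
          · exact h2
        rw [h1.neg_one_pow, h2.neg_one_pow, neg_neg] at hk; exact htwo hk.symm

end TwistSetup


/-! ## HalfStepPM (provider B), part 5d-i — the sign comparison between the exponent data at `s`
(`k = s·k₁`) and at `1` (`k₁`): same parity classes, signs equal up to a GLOBAL factor per class. -/

namespace TwistSetup

/-- `(−1)^{⌊s k₁/2⌋} = ε(k₁) · (−1)^{⌊k₁/2⌋}` with `ε = 1` for even `k₁` and `ε = (−1)^{⌊s/2⌋}` for odd `k₁`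
(`s` odd). [folklore] -/
theorem neg_one_pow_mul_div_two {s : ℕ} (hs : Odd s) (k₁ : ℕ) :
    ((-1 : ℤ)) ^ (s * k₁ / 2) = (if Even k₁ then 1 else (-1) ^ (s / 2)) * (-1) ^ (k₁ / 2) := by
  obtain ⟨b, hb⟩ := hs
  rcases Nat.even_or_odd k₁ with ⟨a, ha⟩ | ⟨a, ha⟩
  · have hk : Even k₁ := ⟨a, ha⟩
    rw [if_pos hk, one_mul]
    have h1 : s * k₁ / 2 = s * a := by
      rw [ha, show s * (a + a) = 2 * (s * a) by ring]; omega
    have h2 : k₁ / 2 = a := by omega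
    rw [h1, h2, pow_mul, hb, pow_succ, pow_mul]
    norm_num
  · have hk : ¬ Even k₁ := Nat.not_even_iff_odd.mpr ⟨a, ha⟩
    rw [if_neg hk]
    have h1 : s * k₁ / 2 = 2 * (a * b) + a + b := by
      rw [ha, hb, show (2 * b + 1) * (2 * a + 1) = 2 * (2 * (a * b) + a + b) + 1 by ring]; omega
    have h2 : k₁ / 2 = a := by omega
    have h3 : s / 2 = b := by omega
    rw [h1, h2, h3, pow_add, pow_add, pow_mul]
    norm_num
    ring

/-- Same parity classes: `Even (s·k₁) ↔ Even k₁` for odd `s`. [folklore] -/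
theorem even_mul_iff_of_odd {s : ℕ} (hs : Odd s) (k₁ : ℕ) : Even (s * k₁) ↔ Even k₁ := by
  rw [Nat.even_mul]
  exact ⟨fun h => h.resolve_left (Nat.not_even_iff_odd.mpr hs), fun h => Or.inr h⟩

end TwistSetup


/-! ## HalfStepPM (provider B), part 5d-ii — the vector-level sign comparison: part 3's signed parity
vector at the point `s` (exponent data `k = s·k₁`) is `±` the one with the `s`-independent data `k₁`. -/

namespace TwistSetup

variable {p : ℕ} [Fact p.Prime] (S : TwistSetup p) {h Lb : ℕ}

open Classical in
/-- `C_par(s)[k := s·k₁] = ε · C_par(s)[k := k₁]`, `ε ∈ {1, (−1)^{⌊s/2⌋}}` (even / odd class), for odd `s`;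
in particular the two vanish together. [folklore] -/
theorem signedVec_mul_eq {J₀ J : ℕ} (B : Finset (Idx S.d h Lb)) (c : Idx S.d h Lb → ℤ) (τ : Tau S.d)
    {s : ℕ} (hs : Odd s) (k₁ : Idx S.d h Lb → ℕ) (par : Prop) (T' : Finset (Fin (S.d + 1))) :
    (∑ u ∈ (B.filter fun u => (Even (s * k₁ u) ↔ par)) with S.toQ.flat.Sset u s = T',
        (((-1) ^ (s * k₁ u / 2) * c u : ℤ) : ℚ) *
          ((S.frame.qΔ J₀ (J + 1) u τ.1 s * S.frame.qA u τ.2) * S.toQ.qEh u s)) =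
      ((if par then (1 : ℤ) else (-1) ^ (s / 2) : ℤ) : ℚ) *
        ∑ u ∈ (B.filter fun u => (Even (k₁ u) ↔ par)) with S.toQ.flat.Sset u s = T',
          (((-1) ^ (k₁ u / 2) * c u : ℤ) : ℚ) *
            ((S.frame.qΔ J₀ (J + 1) u τ.1 s * S.frame.qA u τ.2) * S.toQ.qEh u s) := by
  have hfilt : (B.filter fun u => (Even (s * k₁ u) ↔ par)) = B.filter fun u => (Even (k₁ u) ↔ par) :=
    filter_congr fun u _ => by rw [even_mul_iff_of_odd hs]
  rw [hfilt, mul_sum]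
  refine sum_congr rfl fun u hu => ?_
  have hpar : (Even (k₁ u) ↔ par) := (mem_filter.mp (mem_filter.mp hu).1).2
  rw [neg_one_pow_mul_div_two hs (k₁ u)]
  by_cases hk : Even (k₁ u)
  · have hp : par := hpar.mp hk
    rw [if_pos hk, if_pos hp]; push_cast; ring
  · have hp : ¬ par := fun h' => hk (hpar.mpr h')
    rw [if_neg hk, if_neg hp]; push_cast; ring

end TwistSetup


/-! ## HalfStepPM (provider B), part 5c — identification of part 4's restricted class-sum vector with
part 3's signed parity vector (over the support). -/

namespace TwistSetup

variable {p : ℕ} [Fact p.Prime] (S : TwistSetup p) {h Lb : ℕ}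

open Classical in
/-- **The restricted class-sum vector IS the signed parity vector.** With `c = sgn·pv`, `χ = (−1)^{⌊k/2⌋}·sgn`
and the exponent classes of part 5a (common `c₀`), for the pivot `u₀`:
`classVec(box, [cls = cls u₀]·χ·pv)(T') = ∑_{u ∈ supp(c) ∩ {k ≡ k(u₀)}, Sset = T'} (−1)^{⌊k/2⌋} c(u) · (qΔ_{J+1} qA · qEh)(u)`.
[folklore] -/
theorem classVec_restrict_eq {ζ : ℚ_[p]} {M : ℕ} (hζM : ζ ^ M = -1) (hζ0 : ζ ≠ 0) (r : Fin (S.d + 1) → ℕ)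
    (hη : ∀ i, S.η i = ζ ^ r i) (J₀ J : ℕ) (box : Finset (Idx S.d h Lb)) (pv sgn c χ : Idx S.d h Lb → ℤ)
    (k : Idx S.d h Lb → ℕ) (u₀ : Idx S.d h Lb) (τ : Tau S.d) {s c₀ : ℕ} (hs : Odd s)
    (hc : ∀ u, c u = sgn u * pv u) (hχ : ∀ u, χ u = (-1) ^ (k u / 2) * sgn u)
    (hsgn : ∀ u, pv u ≠ 0 → sgn u = 1 ∨ sgn u = -1)
    (hpm : ∀ u ∈ box, pv u ≠ 0 → S.cls u = S.cls u₀ ∨ S.cls u = -S.cls u₀)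
    (hE : ∀ u ∈ box, pv u ≠ 0 → ∑ i, r i * S.frame.expn u s i = c₀ + k u * M)
    (hE₀ : ∑ i, r i * S.frame.expn u₀ s i = c₀ + k u₀ * M) :
    S.toQ.classVec J₀ J box (fun u => if S.cls u = S.cls u₀ then χ u * pv u else 0) τ s =
      fun T' => ∑ u ∈ ((box.filter fun u => c u ≠ 0).filter fun u => (Even (k u) ↔ Even (k u₀)))
          with S.toQ.flat.Sset u s = T',
        (((-1) ^ (k u / 2) * c u : ℤ) : ℚ) *
          ((S.frame.qΔ J₀ (J + 1) u τ.1 s * S.frame.qA u τ.2) * S.toQ.qEh u s) := by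
  funext T'
  unfold SetupQ.classVec SetupQ.rHalf
  rw [sum_filter, sum_filter, sum_filter, sum_filter]
  refine sum_congr rfl fun u hu => ?_
  dsimp only
  by_cases h0 : pv u = 0
  · have hc0 : c u = 0 := by rw [hc, h0, mul_zero]
    simp [h0, hc0]
  · have hcne : c u ≠ 0 := by
      rw [hc]; exact mul_ne_zero (by rcases hsgn u h0 with h1 | h1 <;> simp [h1]) h0
    have hiff := S.cls_eq_iff_parity hζM hζ0 r hη hs (hE u hu h0) hE₀ (hpm u hu h0)
    by_cases hcl : S.cls u = S.cls u₀
    · have hpar : (Even (k u) ↔ Even (k u₀)) := hiff.mp hcl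
      rw [if_pos hcne, if_pos hpar, if_pos hcl]
      by_cases hT : S.toQ.flat.Sset u s = T'
      · rw [if_pos hT, if_pos hT, hχ, hc]; push_cast; ring
      · rw [if_neg hT, if_neg hT]
    · have hpar : ¬ (Even (k u) ↔ Even (k u₀)) := fun h' => hcl (hiff.mpr h')
      rw [if_pos hcne, if_neg hpar, if_neg hcl]
      simp

end TwistSetup



end Summit.ABC.StewartYu

end
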